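import Summits.CriticalPhenomena.SAWScalingLimit.Theses.SAWRenewalTightness
import Literature.Probability.LatticeModels.MeshDomainBigComponents
import Literature.Topology.PlaneTopology.JordanDomainLocalJoin
import Literature.Topology.PlaneTopology.Rectangles
import Literature.Probability.Percolation.BoxCrossingProofs
import HarnessLib

/-!
# Germ escape at a boundary point of a Jordan domain (lattice level)

Crux `stmt-CriticalPhenomena-17587` (`ConfinementPositivity`), line Sketch (sign-universality),
stub `germEscape` (lemma 0 of the junction J / non-vacuity of the standard-pair statement SPC).

**Theorem** (`germEscape`). Let `D` be a Jordan domain, `a ∈ ∂D` and `ρ > 0`. There are a compact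
`K ⊆ D ∩ B(a, ρ)`, an inner radius `ρ₀ > 0` and a mesh threshold `δ₀ > 0` such that for every mesh
`0 < δ < δ₀`, every lattice point `x` of the main discrete domain `meshDomain D δ` with `δx ∈ B(a, ρ₀)`
is joined to a lattice point `y` with `δy ∈ K` by a path of the mesh vertex graph of the germ ball
`D ∩ B(a, ρ)`.

Proof. *Continuum step (Schoenflies).* Composing the Schoenflies homeomorphisms of the open square
`M = (-1,1)²` and of `D` gives `Φ : ℂ ≃ₜ ℂ` with `Φ '' M = D`. With `a'' = Φ⁻¹ a ∈ M̄` and `r₁` small,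
the open rectangle `R = M ∩ (a'' + (-r₁, r₁)²)` is a Jordan domain with `M ∩ B(a'', r₁) ⊆ R`, so
`D' = Φ(R)` is a Jordan domain with `D ∩ B(a, ρ₁) ⊆ D' ⊆ D ∩ B(a, ρ)` for `ρ₁` small (continuity of
`Φ` at `a''` and of `Φ⁻¹` at `a`). *Lattice step.* Take `K` a closed disc in `D'`, `ρ₀ = ρ₁ / 4`.
For small `δ`, a main-component point `x` with `δx ∈ B(a, ρ₀)` is joined in the mesh graph of `D` to
a lattice point far from `a` (`JordanDomain.exists_forall_mem_meshDomain_and_reachable` for `D`);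
the initial piece of such a path up to the first exit from `B(a, ρ₁/2)` is a path of the mesh graph
of `D'` of Euclidean extent `≥ ρ₁ / 4`, so `x` lies in the main component of `D'`
(`JordanDomain.exists_mem_meshDomain_of_reachable`, big components are the bulk), which is one
component containing the lattice points of `K` (`JordanDomain.exists_forall_mem_meshDomain_and_reachable`
for `D'`); finally mesh paths of `D'` are mesh paths of `D ∩ B(a, ρ) ⊇ D'`.
-/

noncomputable section
open scoped Topology
open Set Metric
open Literature.Probability.RandomPlanarGeometry Literature.Probability.LatticeModels
open Literature.Topology.PlaneTopology

namespace Summit.CriticalPhenomena.SAWScalingLimit.Theorems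

namespace GermEscape

/-- **Monotonicity of mesh paths in the domain.** A path of the mesh vertex graph of `Ω₁` is a
path of the mesh vertex graph of any larger `Ω₂ ⊇ Ω₁` (vertices stay vertices, and closed mesh
edges in `closure Ω₁` lie in `closure Ω₂`). [folklore] -/
theorem reachable_mono {Ω₁ Ω₂ : Set ℂ} {δ : ℝ} (h : Ω₁ ⊆ Ω₂) {x y : Site 2}
    (hx : x ∈ meshVertices Ω₁ δ) (hy : y ∈ meshVertices Ω₁ δ)
    (hr : (meshVertexGraph Ω₁ δ).Reachable ⟨x, hx⟩ ⟨y, hy⟩) :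
    (meshVertexGraph Ω₂ δ).Reachable ⟨x, h hx⟩ ⟨y, h hy⟩ := by
  let f : meshVertexGraph Ω₁ δ →g meshVertexGraph Ω₂ δ :=
    { toFun := fun v => ⟨v.1, h v.2⟩
      map_rel' := fun {u v} huv => by
        have huv' : (meshGraph Ω₁ δ).Adj (u : Site 2) (v : Site 2) := huv
        show (meshGraph Ω₂ δ).Adj (u : Site 2) (v : Site 2)
        rw [meshGraph_adj_iff] at huv' ⊢
        exact ⟨huv'.1, huv'.2.trans (closure_mono h)⟩ }
  exact hr.map f

/-- **First exit.** Let `Ω ∩ B(a, ρ₁) ⊆ Ω'` and `0 ≤ δ ≤ ρ₁ / 2`. A path of the mesh vertex graph of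
`Ω` from a vertex `u` with `δu ∈ B(a, ρ₁/2)` to a vertex `v` with `dist (δv) a ≥ ρ₁ / 2` contains a
vertex `x'` with `dist (δx') a ≥ ρ₁ / 2` joined to `u` in the mesh vertex graph of `Ω'` (the initial
piece up to the first exit from `B(a, ρ₁/2)` stays in `B(a, ρ₁/2 + δ) ⊆ B(a, ρ₁)`; its closed edges
lie in `closure Ω ∩ B(a, ρ₁) ⊆ closure (Ω ∩ B(a, ρ₁)) ⊆ closure Ω'`). [folklore] -/
theorem exists_exit_reachable {Ω Ω' : Set ℂ} {δ ρ₁ : ℝ} {a : ℂ} (hδ : 0 ≤ δ) (hδρ : δ ≤ ρ₁ / 2)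
    (hsub : Ω ∩ ball a ρ₁ ⊆ Ω') :
    ∀ {u v : meshVertices Ω δ} (_ : (meshVertexGraph Ω δ).Walk u v),
      dist (meshPoint δ (u : Site 2)) a < ρ₁ / 2 → ρ₁ / 2 ≤ dist (meshPoint δ (v : Site 2)) a →
      ∃ (x' : Site 2) (hu : (u : Site 2) ∈ meshVertices Ω' δ) (hx' : x' ∈ meshVertices Ω' δ),
        ρ₁ / 2 ≤ dist (meshPoint δ x') a ∧
        (meshVertexGraph Ω' δ).Reachable ⟨u, hu⟩ ⟨x', hx'⟩ := by
  intro u v p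
  induction p with
  | nil => intro hu hv; exact absurd hu (not_lt.2 hv)
  | @cons u w v hadj p ih =>
    intro hu hv
    have hadj' : (meshGraph Ω δ).Adj (u : Site 2) (w : Site 2) := hadj
    rw [meshGraph_adj_iff] at hadj'
    -- both ends of the first edge lie in `B(a, ρ₁)`
    have hwu : dist (meshPoint δ (w : Site 2)) (meshPoint δ (u : Site 2)) ≤ δ := by
      rw [dist_comm, Literature.Probability.Percolation.dist_meshPoint_of_adj hadj'.1, abs_of_nonneg hδ]
    have hwa : dist (meshPoint δ (w : Site 2)) a < ρ₁ := by
      linarith [dist_triangle (meshPoint δ (w : Site 2)) (meshPoint δ (u : Site 2)) a]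
    have hua : dist (meshPoint δ (u : Site 2)) a < ρ₁ := by linarith
    have huΩ' : (u : Site 2) ∈ meshVertices Ω' δ := hsub ⟨u.2, mem_ball.2 hua⟩
    have hwΩ' : (w : Site 2) ∈ meshVertices Ω' δ := hsub ⟨w.2, mem_ball.2 hwa⟩
    -- the first edge is an edge of the mesh graph of `Ω'`
    have hedge : (meshVertexGraph Ω' δ).Adj ⟨u, huΩ'⟩ ⟨w, hwΩ'⟩ := by
      show (meshGraph Ω' δ).Adj (u : Site 2) (w : Site 2)
      rw [meshGraph_adj_iff]
      refine ⟨hadj'.1, fun z hz => ?_⟩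
      have hzb : z ∈ ball a ρ₁ :=
        (convex_ball a ρ₁).segment_subset (mem_ball.2 hua) (mem_ball.2 hwa) hz
      have hzc : z ∈ closure Ω := hadj'.2 hz
      have : z ∈ closure (ball a ρ₁ ∩ Ω) := isOpen_ball.inter_closure ⟨hzb, hzc⟩
      exact closure_mono (fun q hq => hsub ⟨hq.2, hq.1⟩) this
    by_cases hfar : ρ₁ / 2 ≤ dist (meshPoint δ (w : Site 2)) a
    · exact ⟨w, huΩ', hwΩ', hfar, hedge.reachable⟩
    · push Not at hfar
      obtain ⟨x', hw', hx', hx'far, hreach⟩ := ih hfar hv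
      exact ⟨x', huΩ', hx', hx'far, hedge.reachable.trans hreach⟩

end GermEscape

open GermEscape in
/-- **Germ escape at a boundary point of a Jordan domain (lattice level).** For a Jordan domain
`D`, a boundary point `a` and a radius `ρ > 0` there are a compact `K ⊆ D ∩ B(a, ρ)`, an inner
radius `ρ₀ > 0` and a mesh threshold `δ₀ > 0` such that for `0 < δ < δ₀` every lattice point `x`
of the main discrete domain `meshDomain D.carrier δ` whose mesh point lies in `B(a, ρ₀)` is joined
to some lattice point `y` with `δy ∈ K` by a path of the mesh vertex graph of the germ ball
`D ∩ B(a, ρ)`. See the module docstring for the proof (Schoenflies sub-domain `D'` with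
`D ∩ B(a, ρ₁) ⊆ D' ⊆ D ∩ B(a, ρ)`, then "the largest mesh component is the bulk" and "big mesh
components are the bulk" for `D'`). [folklore] -/
theorem germEscape : ∀ (D : JordanDomain) (a : ℂ), a ∈ frontier D.carrier → ∀ ρ : ℝ, 0 < ρ →
    ∃ (K : Set ℂ) (ρ₀ δ₀ : ℝ), IsCompact K ∧ K ⊆ D.carrier ∩ Metric.ball a ρ ∧ 0 < ρ₀ ∧ 0 < δ₀ ∧
      ∀ δ : ℝ, 0 < δ → δ < δ₀ → ∀ x ∈ meshDomain D.carrier δ, meshPoint δ x ∈ Metric.ball a ρ₀ →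
        ∃ y : Site 2, meshPoint δ y ∈ K ∧
          ∃ (hx : x ∈ meshVertices (D.carrier ∩ Metric.ball a ρ) δ)
            (hy : y ∈ meshVertices (D.carrier ∩ Metric.ball a ρ) δ),
            (meshVertexGraph (D.carrier ∩ Metric.ball a ρ) δ).Reachable ⟨x, hx⟩ ⟨y, hy⟩ := by
  intro D a ha ρ hρ
  /- ### Continuum step: a Jordan sub-domain `D'` with `D ∩ B(a, ρ₁) ⊆ D' ⊆ D ∩ B(a, ρ)` -/
  -- the model square and the homeomorphism `Φ` with `Φ '' M = D`
  set M : JordanDomain := rect (show (-1 : ℝ) < 1 by norm_num) (show (-1 : ℝ) < 1 by norm_num)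
    with hM_def
  obtain ⟨HM, hHM, -, -⟩ := exists_schoenflies M
  obtain ⟨HD, hHD, -, -⟩ := exists_schoenflies D
  set Φ : ℂ ≃ₜ ℂ := HM.symm.trans HD with hΦ_def
  have hΦM : Φ '' M.carrier = D.carrier := by
    have hcoe : (Φ : ℂ → ℂ) = HD ∘ HM.symm := funext fun z => rfl
    have h1 : HM.symm '' M.carrier = ball 0 1 := by
      rw [← hHM, ← Set.image_comp, HM.symm_comp_self, Set.image_id]
    rw [hcoe, Set.image_comp, h1, hHD]
  have hΦcl : Φ '' closure M.carrier = closure D.carrier := by rw [Φ.image_closure, hΦM]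
  -- the preimage `a''` of `a` lies in the closed square
  set a'' : ℂ := Φ.symm a with ha''_def
  have hΦa'' : Φ a'' = a := Φ.apply_symm_apply a
  have ha''cl : a'' ∈ closure M.carrier := by
    have : a ∈ Φ '' closure M.carrier := by rw [hΦcl]; exact frontier_subset_closure ha
    obtain ⟨z, hz, hza⟩ := this
    have : a'' = z := by rw [ha''_def, ← hza, Φ.symm_apply_apply]
    rw [this]; exact hz
  have hMcl : closure M.carrier = Icc (-1 : ℝ) 1 ×ℂ Icc (-1 : ℝ) 1 := closure_rect_carrier _ _
  rw [hMcl, Complex.mem_reProdIm, mem_Icc, mem_Icc] at ha''cl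
  obtain ⟨⟨hre1, hre2⟩, him1, him2⟩ := ha''cl
  -- `r₁`: continuity of `Φ` at `a''`
  obtain ⟨r, hr, hrΦ⟩ := Metric.continuous_iff.1 Φ.continuous a'' ρ hρ
  set r₁ : ℝ := r / 3 with hr₁_def
  have hr₁ : 0 < r₁ := by positivity
  have hΦball : ∀ z : ℂ, |z.re - a''.re| < r₁ + r₁ / 2 → |z.im - a''.im| < r₁ + r₁ / 2 →
      Φ z ∈ ball a ρ := by
    intro z hzre hzim
    rw [mem_ball, ← hΦa'']
    apply hrΦ
    rw [Complex.dist_eq]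
    refine (Complex.norm_le_abs_re_add_abs_im _).trans_lt ?_
    rw [Complex.sub_re, Complex.sub_im]
    linarith
  -- the rectangle `R = M ∩ (a'' + (-r₁, r₁)²)` and `D' = Φ(R)`
  have hRre : max (-1 : ℝ) (a''.re - r₁) < min 1 (a''.re + r₁) := by
    rw [max_lt_iff, lt_min_iff, lt_min_iff]; exact ⟨⟨by norm_num, by linarith⟩, by linarith, by linarith⟩
  have hRim : max (-1 : ℝ) (a''.im - r₁) < min 1 (a''.im + r₁) := by
    rw [max_lt_iff, lt_min_iff, lt_min_iff]; exact ⟨⟨by norm_num, by linarith⟩, by linarith, by linarith⟩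
  set R : JordanDomain := rect hRre hRim with hR_def
  set D' : JordanDomain := R.map Φ with hD'_def
  have hD'c : D'.carrier = Φ '' R.carrier := JordanDomain.carrier_map R Φ
  have hRc : R.carrier = Ioo (max (-1 : ℝ) (a''.re - r₁)) (min 1 (a''.re + r₁)) ×ℂ
      Ioo (max (-1 : ℝ) (a''.im - r₁)) (min 1 (a''.im + r₁)) := rect_carrier _ _
  have hMc : M.carrier = Ioo (-1 : ℝ) 1 ×ℂ Ioo (-1 : ℝ) 1 := rect_carrier _ _
  -- (F1) `D' ⊆ D ∩ B(a, ρ)`, and even `closure`-free: every point of `Φ(R)` is in `D` and in the ball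
  have hD'sub : D'.carrier ⊆ D.carrier ∩ ball a ρ := by
    rw [hD'c]
    rintro _ ⟨z, hz, rfl⟩
    rw [hRc, Complex.mem_reProdIm, mem_Ioo, mem_Ioo, max_lt_iff, lt_min_iff, max_lt_iff, lt_min_iff] at hz
    obtain ⟨⟨⟨hz1, hz2⟩, hz3, hz4⟩, ⟨hz5, hz6⟩, hz7, hz8⟩ := hz
    refine ⟨?_, hΦball z (abs_lt.2 ⟨by linarith, by linarith⟩) (abs_lt.2 ⟨by linarith, by linarith⟩)⟩
    rw [← hΦM]
    exact mem_image_of_mem Φ (by rw [hMc, Complex.mem_reProdIm, mem_Ioo, mem_Ioo]; exact ⟨⟨hz1, hz3⟩, hz5, hz7⟩)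
  -- a point `q₀ ∈ D`, necessarily different from `a`
  obtain ⟨q₀, hq₀⟩ := D.nonempty
  have haD : a ∉ D.carrier := fun h => by
    have ha' := ha
    rw [D.isOpen.frontier_eq] at ha'
    exact ha'.2 h
  have hq₀a : 0 < dist q₀ a := dist_pos.2 fun h => haD (h ▸ hq₀)
  -- `ρ₁`: continuity of `Φ⁻¹` at `a`, and `ρ₁ ≤ dist q₀ a / 2`
  obtain ⟨r', hr', hr'Φ⟩ := Metric.continuous_iff.1 Φ.symm.continuous a r₁ hr₁
  set ρ₁ : ℝ := min r' (dist q₀ a / 2) with hρ₁_def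
  have hρ₁ : 0 < ρ₁ := lt_min hr' (by positivity)
  have hρ₁r' : ρ₁ ≤ r' := min_le_left _ _
  have hρ₁q : ρ₁ ≤ dist q₀ a / 2 := min_le_right _ _
  -- (F4) `D ∩ B(a, ρ₁) ⊆ D'`
  have hD'sup : D.carrier ∩ ball a ρ₁ ⊆ D'.carrier := by
    rintro w ⟨hwD, hwa⟩
    rw [mem_ball] at hwa
    have hw' : dist (Φ.symm w) a'' < r₁ := hr'Φ w (hwa.trans_le hρ₁r')
    have hwM : Φ.symm w ∈ M.carrier := by
      rw [← hΦM] at hwD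
      obtain ⟨z, hz, rfl⟩ := hwD
      rwa [Φ.symm_apply_apply]
    rw [hMc, Complex.mem_reProdIm, mem_Ioo, mem_Ioo] at hwM
    have hnorm : ‖Φ.symm w - a''‖ < r₁ := by rwa [← Complex.dist_eq]
    have hre : |(Φ.symm w).re - a''.re| < r₁ := by
      rw [← Complex.sub_re]; exact (Complex.abs_re_le_norm _).trans_lt hnorm
    have him : |(Φ.symm w).im - a''.im| < r₁ := by
      rw [← Complex.sub_im]; exact (Complex.abs_im_le_norm _).trans_lt hnorm
    rw [abs_lt] at hre him
    rw [hD'c]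
    refine ⟨Φ.symm w, ?_, Φ.apply_symm_apply w⟩
    rw [hRc, Complex.mem_reProdIm, mem_Ioo, mem_Ioo, max_lt_iff, lt_min_iff, max_lt_iff, lt_min_iff]
    exact ⟨⟨⟨hwM.1.1, by linarith⟩, hwM.1.2, by linarith⟩, ⟨hwM.2.1, by linarith⟩, hwM.2.2, by linarith⟩
  /- ### The compacts `K ⊆ D'` and `K_D ⊆ D` -/
  obtain ⟨p, hp⟩ := D'.nonempty
  obtain ⟨εp, hεp, hpball⟩ := Metric.isOpen_iff.1 D'.isOpen p hp
  set K : Set ℂ := closedBall p (εp / 2) with hK_def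
  have hKD' : K ⊆ D'.carrier := (closedBall_subset_ball (by linarith)).trans hpball
  obtain ⟨εq, hεq, hqball⟩ := Metric.isOpen_iff.1 D.isOpen q₀ hq₀
  set KD : Set ℂ := closedBall q₀ (εq / 2) with hKD_def
  have hKDD : KD ⊆ D.carrier := (closedBall_subset_ball (by linarith)).trans hqball
  /- ### Lattice thresholds -/
  obtain ⟨δ₁, hδ₁, h1⟩ := D'.exists_forall_mem_meshDomain_and_reachable (isCompact_closedBall p (εp / 2)) hKD'
  obtain ⟨δ₂, hδ₂, h2⟩ := D'.exists_mem_meshDomain_of_reachable (show 0 < ρ₁ / 4 by positivity)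
  obtain ⟨δ₃, hδ₃, h3⟩ := D.exists_forall_mem_meshDomain_and_reachable (isCompact_closedBall q₀ (εq / 2)) hKDD
  refine ⟨K, ρ₁ / 4, min (min δ₁ (min δ₂ δ₃)) (min (min (εp / 2) (εq / 2)) (ρ₁ / 4)),
    isCompact_closedBall p (εp / 2), hKD'.trans hD'sub, by positivity, by positivity, ?_⟩
  intro δ hδ hδlt x hxD hxa
  have hδδ₁ : δ < δ₁ := hδlt.trans_le ((min_le_left _ _).trans (min_le_left _ _))
  have hδδ₂ : δ < δ₂ := hδlt.trans_le ((min_le_left _ _).trans ((min_le_right _ _).trans (min_le_left _ _)))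
  have hδδ₃ : δ < δ₃ := hδlt.trans_le ((min_le_left _ _).trans ((min_le_right _ _).trans (min_le_right _ _)))
  have hδεp : δ ≤ εp / 2 := hδlt.le.trans ((min_le_right _ _).trans ((min_le_left _ _).trans (min_le_left _ _)))
  have hδεq : δ ≤ εq / 2 := hδlt.le.trans ((min_le_right _ _).trans ((min_le_left _ _).trans (min_le_right _ _)))
  have hδρ₁ : δ ≤ ρ₁ / 4 := hδlt.le.trans ((min_le_right _ _).trans (min_le_right _ _))
  rw [mem_ball] at hxa
  /- ### A mesh path of `D` from `x` to a far lattice point -/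
  set yD : Site 2 := nearestSite δ q₀ with hyD_def
  have hyDq : dist (meshPoint δ yD) q₀ ≤ δ := dist_meshPoint_nearestSite_le hδ q₀
  have hyDK : meshPoint δ yD ∈ KD := mem_closedBall.2 (hyDq.trans hδεq)
  have hyDdom : yD ∈ meshDomain D.carrier δ := (h3 δ hδ hδδ₃).1 yD hyDK
  obtain ⟨hxv, hyv, ⟨P⟩⟩ := (h3 δ hδ hδδ₃).2 x hxD yD hyDdom
  have hxa2 : dist (meshPoint δ x) a < ρ₁ / 2 := by linarith
  have hyDa : ρ₁ / 2 ≤ dist (meshPoint δ yD) a := by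
    linarith [dist_triangle q₀ (meshPoint δ yD) a, dist_comm q₀ (meshPoint δ yD)]
  /- ### First exit from `B(a, ρ₁/2)`: a `D'`-mesh path of extent `≥ ρ₁/4`, so `x ∈ meshDomain D'` -/
  obtain ⟨x', hxD', hx'D', hx'far, hreach'⟩ :=
    exists_exit_reachable (Ω := D.carrier) (Ω' := D'.carrier) hδ.le (by linarith) hD'sup P hxa2 hyDa
  have hd₀ : ρ₁ / 4 ≤ dist (meshPoint δ x) (meshPoint δ x') := by
    linarith [dist_triangle (meshPoint δ x') (meshPoint δ x) a, dist_comm (meshPoint δ x') (meshPoint δ x)]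
  have hxdom' : x ∈ meshDomain D'.carrier δ := h2 δ hδ hδδ₂ ⟨x, hxD'⟩ ⟨x', hx'D'⟩ hreach' hd₀
  /- ### The target lattice point in `K`, in the same (main) component of `D'` -/
  set y : Site 2 := nearestSite δ p with hy_def
  have hyK : meshPoint δ y ∈ K := mem_closedBall.2 ((dist_meshPoint_nearestSite_le hδ p).trans hδεp)
  have hydom' : y ∈ meshDomain D'.carrier δ := (h1 δ hδ hδδ₁).1 y hyK
  obtain ⟨hx1, hy1, hreach1⟩ := (h1 δ hδ hδδ₁).2 x hxdom' y hydom'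
  /- ### Transfer to the germ ball `D ∩ B(a, ρ) ⊇ D'` -/
  exact ⟨y, hyK, hD'sub hx1, hD'sub hy1, reachable_mono hD'sub hx1 hy1 hreach1⟩

end Summit.CriticalPhenomena.SAWScalingLimit.Theorems
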